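import Literature.NumberTheory.Automorphic.WeaklyRegularGaloisRep
import Literature.NumberTheory.GaloisRepresentations.WeilLAdicCharacterProofs
import Literature.NumberTheory.GaloisRepresentations.FramedRepTwist
import Literature.NumberTheory.GaloisRepresentations.TwistedSumAssembly
import Summits.Langlands.Langlands.Theorems.IrreducibilityBySelfDualityIrreducibleGL3CMContinuousSemisimplification
import Summits.Langlands.Langlands.Theorems.QuadraticWindowTwistUnpackagingAssembly
import HarnessLib

/-!
# Galois representations over the CM field — stub `stub_galoisOverK` of line `one-transparent-pane`
(crux `Summit.Langlands.Langlands.Theses.QuadraticWindow.HostInducedRep`, item stmt-Langlands-10902)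

Setting.  `K` a CM field with complex conjugation `c`, `P` a cuspidal automorphic representation of
`GL_N(𝔸_K)` (Borel–Jacquet datum) with an infinity type `T` that is `C`-algebraic and weakly regular
(Fakhruddin–Pilloni, §9.1), conjugate self-dual — here in the PAIRING form `P^c ≅ P^∨`
(`AutomorphicRepData.IsEssConjSelfDual P 1`) — and odd (standard Asai sign, `HasAsaiSign c 1`), and
`ψ` an algebraic Hecke character of `K`; `ℓ` a prime, `ι : ℚ̄_ℓ ≃+* ℂ`.

Statement (`stub_galoisOverK_ess`).  Given Fakhruddin–Pilloni, Thm. 9.10 (tree named fact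
`FakhruddinPilloni2021_galoisRep_of_weaklyRegular_odd`, a hypothesis), there is a continuous
SEMISIMPLE `r : Γ_K → GL_N(ℚ̄_ℓ)` which, at every finite place `u ∤ ℓ` where `P` has Satake parameter
`β` and `ψ` is unramified, is unramified with arithmetic-Frobenius characteristic polynomial
`arithFrobPolyOfSatake ι q_u N (β · ψ(ϖ_u)⁻¹)` — the Galois representation of "`P ⊗ (ψ ∘ det)⁻¹`" read
through the Satake parameters of `P` and the values of `ψ` at uniformizers.

Proof.  `r₀ := ρ_{P,ι}` of Thm. 9.10 (unramified, polynomial `arithFrobPolyOfSatake ι q_u N β`, at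
every `u ∤ ℓ` carrying a Satake parameter); `r_ψ :=` Weil's `ℓ`-adic character of the algebraic `ψ`
(`HeckeCharacter.IsAlgebraic.exists_lAdic`, PROVED in the tree: `X - ι⁻¹(ψ(ϖ_u))⁻¹` at every `u ∤ ℓ`
where `ψ` is unramified); `r₁ := r₀ ⊗ (det r_ψ)⁻¹` (`FramedRep.twist`): on an inertia group above such a
`u` both factors are trivial, and at an arithmetic Frobenius `σ`,
`charpoly r₁(σ) = charpoly(ι⁻¹(ψ(ϖ_u)) · r₀(σ))` is the monic polynomial whose roots are `ι⁻¹(ψ(ϖ_u))`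
times the roots `ι⁻¹(((√q_u)^{N-1} b)⁻¹)` of `arithFrobPolyOfSatake ι q_u N β`
(`TwistedSum.roots_charpoly_smul`), i.e. `arithFrobPolyOfSatake ι q_u N (β · ψ(ϖ_u)⁻¹)`
(`roots_arithFrobPolyOfSatake_map_mul_inv`); finally `r :=` a continuous semisimplification of `r₁`
(`IrreducibleGL3CM.stub_continuousSemisimplification`: same characteristic polynomials and
`r₁ g = 1 → r g = 1`, so unramifiedness and Frobenius polynomials are inherited).

References: N. Fakhruddin, V. Pilloni, J. Inst. Math. Jussieu 22 (2023), Thm. 9.10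
[FakhruddinPilloni2021]; A. Weil, Proc. Int. Symp. Tokyo–Nikko (1956), §2 [Weil1956]; J.-P. Serre,
*Abelian ℓ-adic representations* (1968), Ch. I §2 [SerreAbelianLadic1968]; C. W. Curtis, I. Reiner,
*Methods of Representation Theory* I, §16B (semisimplification).

LOG (worker, 2026-08-16).  This is file A of two.
* PROVED here: `stub_galoisOverK_ess (hFP : FakhruddinPilloni2021_galoisRep_of_weaklyRegular_odd) :
  <registered signature of `stub_galoisOverK` with `P.1.IsConjSelfDualAE (complexConj K)` REPLACED by
  `P.1.IsEssConjSelfDual 1`>` — the whole mathematical content of the stub (F–P 9.10 + Weil's `ℓ`-adic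
  character + twist + continuous semisimplification), conditional only on the EXISTING tree named fact
  `Literature.NumberTheory.Automorphic.FakhruddinPilloni2021_galoisRep_of_weaklyRegular_odd`
  (Fakhruddin–Pilloni, Thm. 9.10; `Literature/NumberTheory/Automorphic/WeaklyRegularGaloisRep.lean`),
  whose hypothesis "conjugate self dual" is the PAIRING form `IsEssConjSelfDual π 1`.
* File B (`work/stubs/GaloisOverKBridge.lean`, target `…HostInducedRepGaloisOverKBridge.lean`, imports
  this file): the NEW inline named fact `JacquetShalika1981_isEssConjSelfDual_of_isConjSelfDualAE`
  (strong multiplicity one for the pair `(Π^c, Π^∨)`: for a cuspidal `Π` on `GL_N/K`, `K` CM, `N ≥ 1`,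
  the a.e.-Satake form `IsConjSelfDualAE` of conjugate self-duality implies the pairing form
  `IsEssConjSelfDual 1`; Jacquet–Shalika 1981 (II) Thm. 4.4 between the tree's two accepted renderings
  of "`Π^c ≅ Π^∨`") and `stub_galoisOverK_cond (hFP) (hSMO : that fact) : <registered signature
  VERBATIM>` (rank `0` by hand, rank `≥ 1` = `hSMO` + `stub_galoisOverK_ess`).  Split off because a new
  `def … : Prop` in Theorems/ is review-queued (dry-run verdict QUEUED), while this file is fact-free.
* THE GAP, confirmed: no PROVED bridge `IsConjSelfDualAE → IsEssConjSelfDual` exists in the tree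
  (`lean search 'IsConjSelfDualAE'`, `'IsEssConjSelfDual'`, `'exists_contragredient'`,
  `StrongMultiplicityOne*`): strong multiplicity one for Borel–Jacquet data is reduced to the
  Jacquet–Shalika named fact `strong_multiplicity_one_gl_sphericalLevel` in the `W`-level form
  (`StrongMultiplicityOneRepData`), but `Π^∨` exists only as the Satake-level NAMED FACT
  `CuspidalAutomorphicRepData.exists_contragredient_satake` and no invariant pairing `Π^c × Π → ℂ` is
  constructed anywhere; building one (Petersson pairing on cusp forms, `(𝔤, K_∞)`-clauses of
  `IsGalConjEssSelfDual`) is not stub-sized.  The converse direction IS in the tree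
  (`IsEssConjSelfDual.eventually_satakeParam_complexConj_eq` with `m = 0`).
* Checked, as asked: F–P's fact gives `r₀.IsUnramifiedAt u` and the Frobenius polynomial at EVERY
  `u ∤ ℓ` carrying a Satake parameter, with no reference to `ψ`; semisimplicity is NOT part of its
  conclusion, whence the semisimplification step (`IrreducibleGL3CM.stub_continuousSemisimplification`,
  landed Theorems file, imported).  The monic/roots lemmas `eq_of_monic_of_roots_eq`,
  `monic_arithFrobPolyOfSatake` are REUSED from the landed sibling
  `QuadraticWindowTwistUnpackagingAssembly` (the gate flagged local copies as near-duplicates).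
* `lean check`: rc 0, errors [], warnings [], sorries 0; axioms of `stub_galoisOverK_ess`:
  {propext, Classical.choice, Quot.sound}.  Audit (advisory): `orphan` only (the theorem is named
  `…_ess`, not the registered `stub_galoisOverK`).
* Recommendation to the lead: EITHER reshape the registered stub to take
  `(hFP : FakhruddinPilloni2021_galoisRep_of_weaklyRegular_odd)
   (hSMO : JacquetShalika1981_isEssConjSelfDual_of_isConjSelfDualAE)` and land `stub_galoisOverK_cond`
  (file B) by name — keeps `IsConjSelfDualAE`, which is what `stub_package` produces and `stub_paneLaw`
  consumes; OR replace `IsConjSelfDualAE c` by `IsEssConjSelfDual 1` in the stub and land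
  `stub_galoisOverK_ess` (this file) by name — then `stub_package` must deliver the pairing form, which
  is harder upstream.  The first is recommended.
-/

set_option linter.dupNamespace false -- project-wide option (lakefile weak.linter.dupNamespace); `Summit.Langlands.Langlands` is the mandated namespace

open Literature.NumberTheory.Automorphic Literature.NumberTheory.GaloisRepresentations
open IsDedekindDomain NumberField Filter Polynomial

namespace Summit.Langlands.Langlands.Theorems.HostInducedRep.OneTransparentPane

open Summit.Langlands.Langlands.Theorems.TwistUnpackaging.KummerChebotarev
  (eq_of_monic_of_roots_eq monic_arithFrobPolyOfSatake)

/-! ### General lemmas (the monic/roots lemmas `eq_of_monic_of_roots_eq`, `monic_arithFrobPolyOfSatake`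
are those of the landed sibling `QuadraticWindowTwistUnpackagingAssembly`) -/

/-- **Untwisting a Satake parameter scales the Frobenius roots**: the roots of
`arithFrobPolyOfSatake ι q m (α · k⁻¹)` are `ι⁻¹(k)` times the roots of `arithFrobPolyOfSatake ι q m α`
(the roots are `ι⁻¹((√q^{m-1} a)⁻¹)`, and `((√q)^{m-1} a k⁻¹)⁻¹ = ((√q)^{m-1} a)⁻¹ k`). [folklore] -/
theorem roots_arithFrobPolyOfSatake_map_mul_inv {ℓ : ℕ} [Fact ℓ.Prime] (ι : PadicAlgCl ℓ ≃+* ℂ)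
    (q m : ℕ) (α : Multiset ℂ) (k : ℂ) :
    (arithFrobPolyOfSatake ι q m (α.map (fun a ↦ a * k⁻¹))).roots =
      (arithFrobPolyOfSatake ι q m α).roots.map (fun x ↦ ι.symm k * x) := by
  rw [roots_arithFrobPolyOfSatake, roots_arithFrobPolyOfSatake, Multiset.map_map, Multiset.map_map]
  refine Multiset.map_congr rfl fun a _ ↦ ?_
  simp only [Function.comp_apply]
  rw [← mul_assoc, mul_inv, inv_inv, map_mul, mul_comm]

/-- **Characteristic polynomial of a scalar multiple, through the roots.**  Over an algebraically
closed field, if `charpoly M = P` and `Q` is a monic polynomial whose roots are `c` times the roots of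
`P` (`c ≠ 0`), then `charpoly (c • M) = Q` (`roots (charpoly (c • M)) = c · roots (charpoly M)`,
`Literature.NumberTheory.GaloisRepresentations.TwistedSum.roots_charpoly_smul`). [folklore] -/
theorem charpoly_smul_eq_of_roots {n : Type*} [Fintype n] [DecidableEq n] {k : Type*} [Field k]
    [IsAlgClosed k] {M : Matrix n n k} {P Q : k[X]} (hM : M.charpoly = P) {c : k} (hc : c ≠ 0)
    (hQ : Q.Monic) (hroots : Q.roots = P.roots.map (fun x ↦ c * x)) : (c • M).charpoly = Q := by
  refine eq_of_monic_of_roots_eq (Matrix.charpoly_monic _) hQ ?_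
  rw [TwistedSum.roots_charpoly_smul _ hc, hM, hroots]

/-! ### The stub, with conjugate self-duality in the pairing form (`IsEssConjSelfDual 1`) -/

/-- **`stub_galoisOverK` with the conjugate self-duality hypothesis in Fakhruddin–Pilloni's
(pairing) form.**  Let `K` be a CM field, `P` a cuspidal automorphic representation of `GL_N(𝔸_K)`
with a `C`-algebraic weakly regular infinity type `T`, conjugate self-dual (`P^c ≅ P^∨`,
`IsEssConjSelfDual P 1`) and odd (standard Asai sign, `HasAsaiSign c 1`), and `ψ` an algebraic Hecke
character of `K`.  GIVEN Fakhruddin–Pilloni, Thm. 9.10 (tree named fact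
`FakhruddinPilloni2021_galoisRep_of_weaklyRegular_odd`, hypothesis `hFP`), for every prime `ℓ` and
`ι : ℚ̄_ℓ ≃+* ℂ` there is a continuous SEMISIMPLE `r : Γ_K → GL_N(ℚ̄_ℓ)` which, at every finite `u ∤ ℓ`
where `P` has Satake parameter `β` and `ψ` is unramified, is unramified with arithmetic-Frobenius
characteristic polynomial `arithFrobPolyOfSatake ι q_u N (β · ψ(ϖ_u)⁻¹)`.
Proof: `r₀ := ρ_{P,ι}` (F–P 9.10: unramified with polynomial `arithFrobPolyOfSatake ι q_u N β` at
every unramified `u ∤ ℓ`); `r_ψ :=` Weil's `ℓ`-adic character of `ψ`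
(`HeckeCharacter.IsAlgebraic.exists_lAdic`: `X - ι⁻¹(ψ(ϖ_u))⁻¹` at unramified `u ∤ ℓ`);
`r₁ := r₀ ⊗ (det r_ψ)⁻¹` (`FramedRep.twist`), unramified where both are, with
`charpoly r₁(σ) = charpoly (ι⁻¹(ψ(ϖ_u)) · r₀(σ))`, whose roots are `ι⁻¹(ψ(ϖ_u))` times those of
`arithFrobPolyOfSatake ι q_u N β`, i.e. the roots of `arithFrobPolyOfSatake ι q_u N (β · ψ(ϖ_u)⁻¹)`
(`roots_arithFrobPolyOfSatake_map_mul_inv`; monic polynomials with the same roots over `ℚ̄_ℓ`);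
`r :=` a continuous semisimplification of `r₁` (`IrreducibleGL3CM.stub_continuousSemisimplification`:
same characteristic polynomials, `r₁ g = 1 → r g = 1`).
[cite: FakhruddinPilloni2021, Thm. 9.10] [cite: Weil1956, §2] -/
theorem stub_galoisOverK_ess :
    FakhruddinPilloni2021_galoisRep_of_weaklyRegular_odd →
    ∀ (N : ℕ) (K : Type) [Field K] [NumberField K] [IsCMField K]
      (hcpt : isCompact_glFiniteIntegralLevel N K) (P : CuspidalAutomorphicRepData N K hcpt)
      (T : InfinityType K N) (ψ : HeckeCharacter K),
      P.1.HasInfinityType T → T.IsCAlgebraic → T.IsWeaklyRegular →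
      P.1.IsEssConjSelfDual 1 →
      P.1.HasAsaiSign (NumberField.IsCMField.complexConj K) 1 → ψ.IsAlgebraic →
    ∀ (ℓ : ℕ) [Fact ℓ.Prime] (ι : PadicAlgCl ℓ ≃+* ℂ),
      ∃ r : FramedGaloisRep K (PadicAlgCl ℓ) N, r.toGaloisRep.IsSemisimple ∧
        ∀ (u : HeightOneSpectrum (𝓞 K)) (β : Multiset ℂ), ((ℓ : ℕ) : 𝓞 K) ∉ u.asIdeal →
          P.1.HasSatakeParamAt u β → ψ.IsUnramifiedAt u →
            r.IsUnramifiedAt u ∧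
              r.HasFrobCharpolyAt u
                (arithFrobPolyOfSatake ι u.residueCard N (β.map (fun b ↦ b * (ψ.valueAtUniformizer u)⁻¹))) := by
  intro hFP N K _ _ _ hcpt P T ψ hT hC hW hsd hodd hψ ℓ _ ι
  -- Fakhruddin–Pilloni, Thm. 9.10, and Weil's `ℓ`-adic character of `ψ`
  obtain ⟨r₀, hr₀⟩ := hFP N K hcpt P T hT hC hW hsd hodd ℓ ι
  obtain ⟨rψ, hrψ⟩ := hψ.exists_lAdic ι
  -- the twisting character `χ' = (det r_ψ)⁻¹ : Γ_K →ₜ* ℚ̄_ℓˣ`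
  obtain ⟨χ', hχ'⟩ : ∃ χ' : Field.absoluteGaloisGroup K →ₜ* (PadicAlgCl ℓ)ˣ,
      ∀ g, χ' g = (Matrix.GeneralLinearGroup.det (rψ g))⁻¹ :=
    ⟨(FramedRep.det rψ)⁻¹, fun _ ↦ rfl⟩
  -- continuous semisimplification of the twist `r₀ ⊗ χ'`
  obtain ⟨r, hss, hcp, hker⟩ :=
    IrreducibleGL3CM.stub_continuousSemisimplification K ℓ N (r₀.twist χ')
  refine ⟨r, hss, fun u β hℓ hβ hψu ↦ ?_⟩
  obtain ⟨h₀unr, h₀frob⟩ := hr₀ u β hβ hℓ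
  obtain ⟨hψunr, hψfrob⟩ := hrψ u hℓ hψu
  refine ⟨fun 𝔓 h𝔓 τ hτ ↦ hker τ ?_, fun 𝔓 h𝔓 σ hσ ↦ ?_⟩
  · -- unramified: both factors die on inertia
    have h1 : r₀ τ = 1 := h₀unr 𝔓 h𝔓 τ hτ
    have h2 : rψ τ = 1 := hψunr 𝔓 h𝔓 τ hτ
    have h3 : χ' τ = 1 := by rw [hχ', h2, map_one, inv_one]
    rw [FramedRep.twist_apply_of_eq_one _ _ h3, h1]
  · -- Frobenius: `charpoly (ι⁻¹(ψ(ϖ_u)) · r₀(σ))` has the roots of the untwisted prediction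
    rw [hcp]
    have hr₀σ : FramedRep.charpoly r₀ σ = arithFrobPolyOfSatake ι u.residueCard N β :=
      h₀frob 𝔓 h𝔓 σ hσ
    have hrψσ := (FramedGaloisRep.hasFrobCharpolyAt_iff_of_rank_one rψ u _).mp hψfrob 𝔓 h𝔓 σ hσ
    have hχ'σ : ((χ' σ : (PadicAlgCl ℓ)ˣ) : PadicAlgCl ℓ) = ι.symm (ψ.valueAtUniformizer u) := by
      rw [hχ', Units.val_inv_eq_inv_val, Matrix.GeneralLinearGroup.val_det_apply,
        Matrix.det_fin_one, hrψσ, map_inv₀, inv_inv]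
    have hk0 : ι.symm (ψ.valueAtUniformizer u) ≠ 0 := by
      rw [← hχ'σ]
      exact Units.ne_zero _
    unfold FramedRep.charpoly at hr₀σ ⊢
    rw [FramedRep.coe_twist_apply, hχ'σ]
    exact charpoly_smul_eq_of_roots hr₀σ hk0 (monic_arithFrobPolyOfSatake ι _ N _)
      (roots_arithFrobPolyOfSatake_map_mul_inv ι _ N β _)


end Summit.Langlands.Langlands.Theorems.HostInducedRep.OneTransparentPane
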